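import Literature.MathematicalPhysics.QuantumManyBody.BogoliubovWeylCalculus
import Literature.MathematicalPhysics.QuantumManyBody.TorusFockSectorInteraction
import HarnessLib

/-!
# The grand-canonical energy functional of a Bogoliubov–Weyl trial state:
# `∑_n ‖Ψ_n‖² E^per(n,L)/‖Ψ‖² ≤ ⟨ξ, 𝒢ξ⟩/‖ξ‖²`, `𝒢 = ∑_p ε(p)A†_pA_p + (2L³)⁻¹∑ W_L A†A†AA`,
# `A_p = γ_pa_p + σ_pa†_{-p} + √N₀δ_{p,0} = T*W*a_pWT`, for `Ψ = W(N₀)T_νξ`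

Topic `Literature/MathematicalPhysics/QuantumManyBody`. This file joins the two halves of the
machinery built for the provefact
`Literature.MathematicalPhysics.QuantumManyBody.BoseGas.BastiCenatiempoSchlein2021_upperBound`
(Prop. 1.3 of [BastiCenatiempoSchlein2021]):

* `BogoliubovWeylCalculus.lean` — the trial vectors `Ψ = (𝒯ξ)Γ = W(N₀)T_νξ` of [ibid., (2.12)] in
  the holomorphic Fock model, sector by sector (`sectorMul`), the Wick isometry
  `⟪𝒯ξ,𝒯ξ'⟫_Γ = ⟪1,1⟫_Γ⟨ξ,ξ'⟩` and the intertwining `d_q𝒯ξ = 𝒯(A_qξ)`,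
  `A_q = conjAn = γ_qa_q + σ_qa†_{σq} + √N₀[q=z]` [ibid., (2.2), (2.11)];
* `TorusFockSectorDictionary.lean` / `TorusFockSectorInteraction.lean` — the variational bound for
  the periodic `n`-boson problem from a homogeneous sector `S` of degree `n` in second-quantised
  form: `E^per(n,L) ≤ (∑_pε(p)‖a_pS‖² + (2L³)⁻¹Re∑[…]W_L⟨a_qa_pS,a_{q'}a_{p'}S⟩)/‖S‖²`
  (`periodicGroundStateEnergy_le_secondQuantised`, [LSSY2005, App. A (A.10)]).

Reading the sectors `Ψ_n = ((𝒯ξ)Γ)_n` (`Fock.trialSector`) through `∂_qΨ_{n+1} = ((𝒯A_qξ)Γ)_n`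
(`Fock.pderiv_trialSector_succ`) and summing the sector series with the Wick isometry gives, for the
**sector weights** `c_n = ‖Ψ_n‖²/‖Ψ‖²` (`Fock.trialWeight`) of the normalised trial state:

* `∑_n c_n = 1` (`Fock.tsum_trialWeight`);
* `∑_n n c_n = ∑_q‖A_qξ‖²/‖ξ‖²` and `∑_n n² c_n = (∑_q‖A_qξ‖² + ∑_{p,q}‖A_pA_qξ‖²)/‖ξ‖²`
  (`Fock.tsum_natCast_mul_trialWeight`, `Fock.tsum_natCast_sq_mul_trialWeight`) — the expectations
  of `𝒩 = ∑a†_pa_p` and `𝒩² = ∑a†_pa_p + ∑a†_pa†_qa_qa_p` in `W(N₀)T_νξ/‖ξ‖`, i.e. the identity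
  `⟨Ψ_N,𝒩Ψ_N⟩ = ⟨ξ,T*W*𝒩WTξ⟩/‖ξ‖²` behind [ibid., Prop. 2.4, (2.14)];
* the **energy functional** (`tsum_trialWeight_mul_periodicGroundStateEnergy_le`):
  `∑_n c_n E^per(n,L) ≤ (∑_p |2πe(p)/L|²‖A_pξ‖²
     + (2L³)⁻¹ Re∑_{e p+e q=e p'+e q'} W_L(e p'-e p)⟨A_qA_pξ, A_{q'}A_{p'}ξ⟩)/‖ξ‖²`,
  the identity `E_N^Ψ = ⟨Ψ_N,ℋ_NΨ_N⟩ = ⟨ξ_ν,𝒢_Nξ_ν⟩/‖ξ_ν‖²`, `𝒢_N = T*_νW*_{N₀}ℋ_NW_{N₀}T_ν` of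
  [ibid., (3.1)] with `ℋ_N` in the momentum form [ibid., (2.1)], combined with the sectorwise
  variational principle — exactly the shape of the hypothesis of
  `BastiCenatiempoSchlein2021_upperBound_of_grandCanonicalLHYBlocks`
  (`DiluteBoseGasUpperBoundGrandCanonical.lean`).

All modes live in a finite set `ι` with injective momentum labels `e : ι → ℤ³` (mode truncation);
no relation between `σ` and `e` is needed at this stage.

## References

* [BastiCenatiempoSchlein2021] G. Basti, S. Cenatiempo, B. Schlein, *A new second-order upper bound
  for the ground state energy of dilute Bose gases*, Forum Math. Sigma 9 (2021) e74
  (arXiv:2101.06222): (2.1) (`ℋ_N` in momentum space), (2.2), (2.11), (2.12) (trial state),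
  Prop. 2.4 and (2.14) (`⟨𝒩⟩`, `⟨𝒩²⟩`), §3 (3.1) (`𝒢_N`).
* [LSSY2005] E. H. Lieb, R. Seiringer, J. P. Solovej, J. Yngvason, *The Mathematics of the Bose Gas
  and its Condensation* (2005), App. A (A.10).
-/

noncomputable section

namespace Literature.MathematicalPhysics.QuantumManyBody.BoseGas

open Complex MvPolynomial Finset MeasureTheory
open scoped ComplexConjugate BigOperators ENNReal NNReal

namespace Fock

variable {ι : Type*} [Fintype ι] [DecidableEq ι] {z : ι} {σ : ι → ι} {P : Finset ι} {N₀ : ℝ}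
  {t : ι → ℝ}

/-! ### The sectors of the trial vector and the annihilation recursion -/

/-- The **`n`-particle sector `Ψ_n = ((𝒯ξ)Γ)_n` of the trial vector `Ψ = W(N₀)T_νξ`** in the
holomorphic model (a homogeneous polynomial of degree `n`).
[cite: BastiCenatiempoSchlein2021, (2.12)] -/
def trialSector (z : ι) (σ : ι → ι) (P : Finset ι) (N₀ : ℝ) (t : ι → ℝ) (ξ : MvPolynomial ι ℂ)
    (n : ℕ) : MvPolynomial ι ℂ :=
  sectorMul z σ P N₀ t (bogT z σ P N₀ t ξ) n

omit [Fintype ι] in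
/-- `Ψ_n` is homogeneous of degree `n`. [folklore] -/
theorem isHomogeneous_trialSector (ξ : MvPolynomial ι ℂ) (n : ℕ) :
    (trialSector z σ P N₀ t ξ n).IsHomogeneous n :=
  isHomogeneous_sectorMul _ _

omit [Fintype ι] in
/-- **The annihilation recursion of the trial sectors**: `a_qΨ_{n+1}[ξ] = Ψ_n[A_qξ]` with
`A_q = γ_qa_q + σ_qa†_{σq} + √N₀[q=z]` — the sector form of `a_qWTξ = WT(T*W*a_qWT)ξ`.
[cite: BastiCenatiempoSchlein2021, (2.2), (2.11)] -/
theorem pderiv_trialSector_succ (hσ : Function.Involutive σ) (hP : ∀ p ∈ P, σ p ∉ P)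
    (hσz : σ z = z) (ht : ∀ p ∈ P, |t p| < 1) (q : ι) (ξ : MvPolynomial ι ℂ) (m : ℕ) :
    pderiv q (trialSector z σ P N₀ t ξ (m + 1)) = trialSector z σ P N₀ t (conjAn z σ P N₀ t q ξ) m := by
  unfold trialSector
  rw [pderiv_sectorMul_succ hσ hP, ← dOp_apply, dOp_bogT hσ hP hσz ht]

omit [Fintype ι] in
/-- `a_qΨ_0 = 0`. [folklore] -/
theorem pderiv_trialSector_zero (q : ι) (ξ : MvPolynomial ι ℂ) :
    pderiv q (trialSector z σ P N₀ t ξ 0) = 0 := by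
  rw [trialSector, eq_C_of_isHomogeneous_zero (isHomogeneous_sectorMul _ 0), pderiv_C]

/-! ### Sector series through the Wick isometry -/

/-- `∑_n ⟨Ψ_n[u], Ψ_n[w]⟩ = ⟪1,1⟫_Γ ⟨u, w⟩`. [cite: BastiCenatiempoSchlein2021, (2.12), (3.1)] -/
theorem hasSum_fockInner_trialSector (hσ : Function.Involutive σ) (hσz : σ z = z)
    (hP : ∀ p ∈ P, σ p ∉ P) (hN₀ : 0 ≤ N₀) (ht : ∀ p ∈ P, |t p| < 1) (u w : MvPolynomial ι ℂ) :
    HasSum (fun n => fockInner (trialSector z σ P N₀ t u n) (trialSector z σ P N₀ t w n))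
      (gaussInner z σ P N₀ t 1 1 * fockInner u w) := by
  have h := hasSum_gaussInner hσ hσz hP hN₀ ht (bogT z σ P N₀ t u) (bogT z σ P N₀ t w)
  rwa [gaussInner_bogT_bogT hσ hσz hP hN₀ ht] at h

omit [Fintype ι] in
/-- `‖Γ‖² = ⟪1,1⟫_Γ` is real. [folklore] -/
theorem gaussInner_one_one_im : (gaussInner z σ P N₀ t 1 1).im = 0 :=
  Complex.conj_eq_iff_im.1 (conj_gaussInner (z := z) (σ := σ) (P := P) (N₀ := N₀) (t := t) 1 1)

/-- `∑_n ‖Ψ_n[u]‖² = ‖Γ‖²‖u‖²`. [cite: BastiCenatiempoSchlein2021, (2.12)] -/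
theorem hasSum_fockInner_trialSector_self_re (hσ : Function.Involutive σ) (hσz : σ z = z)
    (hP : ∀ p ∈ P, σ p ∉ P) (hN₀ : 0 ≤ N₀) (ht : ∀ p ∈ P, |t p| < 1) (u : MvPolynomial ι ℂ) :
    HasSum (fun n => (fockInner (trialSector z σ P N₀ t u n) (trialSector z σ P N₀ t u n)).re)
      ((gaussInner z σ P N₀ t 1 1).re * (fockInner u u).re) := by
  have h := Complex.hasSum_re (hasSum_fockInner_trialSector hσ hσz hP hN₀ ht u u)
  rwa [Complex.mul_re, gaussInner_one_one_im, zero_mul, sub_zero] at h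

/-- `∑_n ‖a_qΨ_n[u]‖² = ‖Γ‖²‖A_qu‖²`. [cite: BastiCenatiempoSchlein2021, (2.11), (2.14)] -/
theorem hasSum_fockInner_pderiv_trialSector_re (hσ : Function.Involutive σ) (hσz : σ z = z)
    (hP : ∀ p ∈ P, σ p ∉ P) (hN₀ : 0 ≤ N₀) (ht : ∀ p ∈ P, |t p| < 1) (q : ι) (u : MvPolynomial ι ℂ) :
    HasSum (fun n => (fockInner (pderiv q (trialSector z σ P N₀ t u n))
        (pderiv q (trialSector z σ P N₀ t u n))).re)
      ((gaussInner z σ P N₀ t 1 1).re *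
        (fockInner (conjAn z σ P N₀ t q u) (conjAn z σ P N₀ t q u)).re) := by
  rw [← hasSum_nat_add_iff' 1]
  simp only [Finset.sum_range_one, pderiv_trialSector_zero, fockInner_zero_left, Complex.zero_re,
    sub_zero, pderiv_trialSector_succ hσ hP hσz ht]
  exact hasSum_fockInner_trialSector_self_re hσ hσz hP hN₀ ht _

/-- **First moment**: `∑_n n‖Ψ_n[u]‖² = ‖Γ‖² ∑_q ‖A_qu‖²` (Euler: `n‖S‖² = ∑_q‖a_qS‖²` on a
sector of degree `n`). [cite: BastiCenatiempoSchlein2021, Prop. 2.4, (2.14)] -/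
theorem hasSum_natCast_mul_fockInner_trialSector_re (hσ : Function.Involutive σ) (hσz : σ z = z)
    (hP : ∀ p ∈ P, σ p ∉ P) (hN₀ : 0 ≤ N₀) (ht : ∀ p ∈ P, |t p| < 1) (u : MvPolynomial ι ℂ) :
    HasSum (fun n : ℕ => (n : ℝ) * (fockInner (trialSector z σ P N₀ t u n) (trialSector z σ P N₀ t u n)).re)
      ((gaussInner z σ P N₀ t 1 1).re *
        ∑ q, (fockInner (conjAn z σ P N₀ t q u) (conjAn z σ P N₀ t q u)).re) := by
  have h := hasSum_sum (s := (Finset.univ : Finset ι))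
    fun q (_ : q ∈ Finset.univ) => hasSum_fockInner_pderiv_trialSector_re hσ hσz hP hN₀ ht q u
  have hfun : (fun n : ℕ => (n : ℝ) * (fockInner (trialSector z σ P N₀ t u n) (trialSector z σ P N₀ t u n)).re) =
      fun n : ℕ => ∑ q, (fockInner (pderiv q (trialSector z σ P N₀ t u n))
        (pderiv q (trialSector z σ P N₀ t u n))).re := by
    funext n
    exact (sum_fockInner_pderiv_self_re (isHomogeneous_trialSector u n)).symm
  rw [hfun, Finset.mul_sum]
  exact h

/-- **Second moment**: `∑_n n²‖Ψ_n[u]‖² = ‖Γ‖² (∑_q ‖A_qu‖² + ∑_{q,p} ‖A_pA_qu‖²)`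
(`𝒩² = ∑_q a†_qa_q + ∑_{p,q} a†_qa†_pa_pa_q`). [cite: BastiCenatiempoSchlein2021, Prop. 2.4] -/
theorem hasSum_natCast_sq_mul_fockInner_trialSector_re (hσ : Function.Involutive σ) (hσz : σ z = z)
    (hP : ∀ p ∈ P, σ p ∉ P) (hN₀ : 0 ≤ N₀) (ht : ∀ p ∈ P, |t p| < 1) (u : MvPolynomial ι ℂ) :
    HasSum (fun n : ℕ => (n : ℝ) ^ 2 *
        (fockInner (trialSector z σ P N₀ t u n) (trialSector z σ P N₀ t u n)).re)
      ((gaussInner z σ P N₀ t 1 1).re *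
        ∑ q, ((fockInner (conjAn z σ P N₀ t q u) (conjAn z σ P N₀ t q u)).re +
          ∑ p, (fockInner (conjAn z σ P N₀ t p (conjAn z σ P N₀ t q u))
            (conjAn z σ P N₀ t p (conjAn z σ P N₀ t q u))).re)) := by
  have h1 : ∀ q : ι, HasSum (fun n : ℕ => (n : ℝ) * (fockInner (pderiv q (trialSector z σ P N₀ t u n))
      (pderiv q (trialSector z σ P N₀ t u n))).re)
      ((gaussInner z σ P N₀ t 1 1).re *
        ((fockInner (conjAn z σ P N₀ t q u) (conjAn z σ P N₀ t q u)).re +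
          ∑ p, (fockInner (conjAn z σ P N₀ t p (conjAn z σ P N₀ t q u))
            (conjAn z σ P N₀ t p (conjAn z σ P N₀ t q u))).re)) := by
    intro q
    have ha := hasSum_fockInner_trialSector_self_re hσ hσz hP hN₀ ht (conjAn z σ P N₀ t q u)
    have hb := hasSum_natCast_mul_fockInner_trialSector_re hσ hσz hP hN₀ ht (conjAn z σ P N₀ t q u)
    have key : HasSum (fun n : ℕ => ((n + 1 : ℕ) : ℝ) *
        (fockInner (pderiv q (trialSector z σ P N₀ t u (n + 1)))
          (pderiv q (trialSector z σ P N₀ t u (n + 1)))).re)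
        ((gaussInner z σ P N₀ t 1 1).re *
          ((fockInner (conjAn z σ P N₀ t q u) (conjAn z σ P N₀ t q u)).re +
            ∑ p, (fockInner (conjAn z σ P N₀ t p (conjAn z σ P N₀ t q u))
              (conjAn z σ P N₀ t p (conjAn z σ P N₀ t q u))).re)) := by
      have hfun : (fun n : ℕ => ((n + 1 : ℕ) : ℝ) *
          (fockInner (pderiv q (trialSector z σ P N₀ t u (n + 1)))
            (pderiv q (trialSector z σ P N₀ t u (n + 1)))).re) =
          fun n : ℕ => (fockInner (trialSector z σ P N₀ t (conjAn z σ P N₀ t q u) n)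
              (trialSector z σ P N₀ t (conjAn z σ P N₀ t q u) n)).re +
            (n : ℝ) * (fockInner (trialSector z σ P N₀ t (conjAn z σ P N₀ t q u) n)
              (trialSector z σ P N₀ t (conjAn z σ P N₀ t q u) n)).re := by
        funext n
        rw [pderiv_trialSector_succ hσ hP hσz ht]
        push_cast
        ring
      rw [hfun, mul_add]
      exact ha.add hb
    refine (hasSum_nat_add_iff' (f := fun n : ℕ => (n : ℝ) *
      (fockInner (pderiv q (trialSector z σ P N₀ t u n)) (pderiv q (trialSector z σ P N₀ t u n))).re) 1).1 ?_
    simp only [Finset.sum_range_one, Nat.cast_zero, zero_mul, sub_zero]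
    exact key
  have h := hasSum_sum (s := (Finset.univ : Finset ι)) fun q (_ : q ∈ Finset.univ) => h1 q
  have hfun : (fun n : ℕ => (n : ℝ) ^ 2 *
      (fockInner (trialSector z σ P N₀ t u n) (trialSector z σ P N₀ t u n)).re) =
      fun n : ℕ => ∑ q, (n : ℝ) * (fockInner (pderiv q (trialSector z σ P N₀ t u n))
        (pderiv q (trialSector z σ P N₀ t u n))).re := by
    funext n
    rw [← Finset.mul_sum, sum_fockInner_pderiv_self_re (isHomogeneous_trialSector u n)]
    ring
  rw [hfun, Finset.mul_sum]
  exact h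

/-- `∑_n ⟨a_qa_pΨ_n[u], a_{q'}a_{p'}Ψ_n[u]⟩ = ‖Γ‖² ⟨A_qA_pu, A_{q'}A_{p'}u⟩`.
[cite: BastiCenatiempoSchlein2021, (2.11), (3.1)] -/
theorem hasSum_fockInner_pderiv_pderiv_trialSector (hσ : Function.Involutive σ) (hσz : σ z = z)
    (hP : ∀ p ∈ P, σ p ∉ P) (hN₀ : 0 ≤ N₀) (ht : ∀ p ∈ P, |t p| < 1) (p q p' q' : ι)
    (u : MvPolynomial ι ℂ) :
    HasSum (fun n => fockInner (pderiv q (pderiv p (trialSector z σ P N₀ t u n)))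
        (pderiv q' (pderiv p' (trialSector z σ P N₀ t u n))))
      (gaussInner z σ P N₀ t 1 1 *
        fockInner (conjAn z σ P N₀ t q (conjAn z σ P N₀ t p u))
          (conjAn z σ P N₀ t q' (conjAn z σ P N₀ t p' u))) := by
  rw [← hasSum_nat_add_iff' 2]
  simp only [Finset.sum_range_succ, Finset.sum_range_zero, pderiv_trialSector_zero,
    map_zero, fockInner_zero_left, pderiv_trialSector_succ hσ hP hσz ht, add_zero, sub_zero]
  exact hasSum_fockInner_trialSector hσ hσz hP hN₀ ht _ _

/-- The pair sums of the sectors resum to the pair form of `ξ`: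
`∑_n Re∑[…]W(⋯)⟨a_qa_pΨ_n, a_{q'}a_{p'}Ψ_n⟩ = ‖Γ‖² Re∑[…]W(⋯)⟨A_qA_pu, A_{q'}A_{p'}u⟩`.
[cite: BastiCenatiempoSchlein2021, (2.1), (3.1)] -/
theorem hasSum_pairSum_trialSector_re (hσ : Function.Involutive σ) (hσz : σ z = z)
    (hP : ∀ p ∈ P, σ p ∉ P) (hN₀ : 0 ≤ N₀) (ht : ∀ p ∈ P, |t p| < 1) (W : Momentum → ℂ)
    (e : ι → Momentum) (u : MvPolynomial ι ℂ) :
    HasSum (fun n => (∑ p, ∑ q, ∑ p', ∑ q', if e p + e q = e p' + e q' then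
        W (e p' - e p) * fockInner (pderiv q (pderiv p (trialSector z σ P N₀ t u n)))
          (pderiv q' (pderiv p' (trialSector z σ P N₀ t u n))) else 0).re)
      ((gaussInner z σ P N₀ t 1 1).re * (∑ p, ∑ q, ∑ p', ∑ q', if e p + e q = e p' + e q' then
        W (e p' - e p) * fockInner (conjAn z σ P N₀ t q (conjAn z σ P N₀ t p u))
          (conjAn z σ P N₀ t q' (conjAn z σ P N₀ t p' u)) else 0).re) := by
  have h : HasSum (fun n => ∑ p, ∑ q, ∑ p', ∑ q', if e p + e q = e p' + e q' then
        W (e p' - e p) * fockInner (pderiv q (pderiv p (trialSector z σ P N₀ t u n)))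
          (pderiv q' (pderiv p' (trialSector z σ P N₀ t u n))) else 0)
      (gaussInner z σ P N₀ t 1 1 * ∑ p, ∑ q, ∑ p', ∑ q', if e p + e q = e p' + e q' then
        W (e p' - e p) * fockInner (conjAn z σ P N₀ t q (conjAn z σ P N₀ t p u))
          (conjAn z σ P N₀ t q' (conjAn z σ P N₀ t p' u)) else 0) := by
    rw [Finset.mul_sum]; refine hasSum_sum fun p _ => ?_
    rw [Finset.mul_sum]; refine hasSum_sum fun q _ => ?_
    rw [Finset.mul_sum]; refine hasSum_sum fun p' _ => ?_
    rw [Finset.mul_sum]; refine hasSum_sum fun q' _ => ?_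
    by_cases hc : e p + e q = e p' + e q'
    · simp only [hc, if_true]
      rw [mul_left_comm]
      exact (hasSum_fockInner_pderiv_pderiv_trialSector hσ hσz hP hN₀ ht p q p' q' u).mul_left _
    · simp only [hc, if_false, mul_zero]
      exact hasSum_zero
  have h' := Complex.hasSum_re h
  rwa [Complex.mul_re, gaussInner_one_one_im, zero_mul, sub_zero] at h'

/-! ### The sector weights of the normalised trial state -/

/-- The **sector weights** `c_n = ‖Ψ_n‖²/‖Ψ‖²` of the normalised trial state
`Ψ/‖Ψ‖ = W(N₀)T_νξ/‖ξ‖`, `‖Ψ‖² = ‖Γ‖²‖ξ‖²`. [cite: BastiCenatiempoSchlein2021, (2.12)] -/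
def trialWeight (z : ι) (σ : ι → ι) (P : Finset ι) (N₀ : ℝ) (t : ι → ℝ) (ξ : MvPolynomial ι ℂ)
    (n : ℕ) : ℝ≥0∞ :=
  ENNReal.ofReal ((fockInner (trialSector z σ P N₀ t ξ n) (trialSector z σ P N₀ t ξ n)).re /
    ((gaussInner z σ P N₀ t 1 1).re * (fockInner ξ ξ).re))

/-- `‖Ψ‖² = ‖Γ‖²‖ξ‖² > 0` for `ξ ≠ 0`. [folklore] -/
theorem trialNormSq_pos (hσ : Function.Involutive σ) (hσz : σ z = z)
    (hP : ∀ p ∈ P, σ p ∉ P) (hN₀ : 0 ≤ N₀) (ht : ∀ p ∈ P, |t p| < 1) {ξ : MvPolynomial ι ℂ}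
    (hξ : ξ ≠ 0) : 0 < (gaussInner z σ P N₀ t 1 1).re * (fockInner ξ ξ).re :=
  mul_pos (lt_of_lt_of_le one_pos (one_le_gaussInner_one_one_re hσ hσz hP hN₀ ht))
    (fockInner_self_re_pos hξ)

/-- **`∑_n c_n = 1`.** [cite: BastiCenatiempoSchlein2021, (2.12)] -/
theorem tsum_trialWeight (hσ : Function.Involutive σ) (hσz : σ z = z)
    (hP : ∀ p ∈ P, σ p ∉ P) (hN₀ : 0 ≤ N₀) (ht : ∀ p ∈ P, |t p| < 1) {ξ : MvPolynomial ι ℂ}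
    (hξ : ξ ≠ 0) : ∑' n, trialWeight z σ P N₀ t ξ n = 1 := by
  have hZ := trialNormSq_pos hσ hσz hP hN₀ ht hξ
  have h := (hasSum_fockInner_trialSector_self_re hσ hσz hP hN₀ ht ξ).div_const
    ((gaussInner z σ P N₀ t 1 1).re * (fockInner ξ ξ).re)
  rw [div_self hZ.ne'] at h
  unfold trialWeight
  rw [← ENNReal.ofReal_tsum_of_nonneg (fun n => div_nonneg (fockInner_self_re_nonneg _) hZ.le)
    h.summable, h.tsum_eq, ENNReal.ofReal_one]

/-- **`∑_n n c_n = ∑_q‖A_qξ‖²/‖ξ‖²`** — the expected particle number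
`⟨Ψ_N, 𝒩Ψ_N⟩ = ⟨ξ, T*W*𝒩WTξ⟩/‖ξ‖²`, `T*W*𝒩WT = ∑_qA†_qA_q`.
[cite: BastiCenatiempoSchlein2021, Prop. 2.4, (2.14)] -/
theorem tsum_natCast_mul_trialWeight (hσ : Function.Involutive σ) (hσz : σ z = z)
    (hP : ∀ p ∈ P, σ p ∉ P) (hN₀ : 0 ≤ N₀) (ht : ∀ p ∈ P, |t p| < 1) {ξ : MvPolynomial ι ℂ}
    (hξ : ξ ≠ 0) :
    ∑' n : ℕ, (n : ℝ≥0∞) * trialWeight z σ P N₀ t ξ n =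
      ENNReal.ofReal ((∑ q, (fockInner (conjAn z σ P N₀ t q ξ) (conjAn z σ P N₀ t q ξ)).re) /
        (fockInner ξ ξ).re) := by
  have hZ := trialNormSq_pos hσ hσz hP hN₀ ht hξ
  have hg : 0 < (gaussInner z σ P N₀ t 1 1).re :=
    lt_of_lt_of_le one_pos (one_le_gaussInner_one_one_re hσ hσz hP hN₀ ht)
  have h := (hasSum_natCast_mul_fockInner_trialSector_re hσ hσz hP hN₀ ht ξ).div_const
    ((gaussInner z σ P N₀ t 1 1).re * (fockInner ξ ξ).re)
  rw [mul_div_mul_left _ _ hg.ne'] at h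
  have hpt : ∀ n : ℕ, (n : ℝ≥0∞) * trialWeight z σ P N₀ t ξ n =
      ENNReal.ofReal ((n : ℝ) * (fockInner (trialSector z σ P N₀ t ξ n)
        (trialSector z σ P N₀ t ξ n)).re / ((gaussInner z σ P N₀ t 1 1).re * (fockInner ξ ξ).re)) := by
    intro n
    rw [trialWeight, mul_div_assoc, ENNReal.ofReal_mul (Nat.cast_nonneg n), ENNReal.ofReal_natCast]
  simp_rw [hpt]
  rw [← ENNReal.ofReal_tsum_of_nonneg (fun n => div_nonneg (mul_nonneg (Nat.cast_nonneg n)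
    (fockInner_self_re_nonneg _)) hZ.le) h.summable, h.tsum_eq]

/-- **`∑_n n² c_n = (∑_q‖A_qξ‖² + ∑_{q,p}‖A_pA_qξ‖²)/‖ξ‖²`** — the expectation of `𝒩²`.
[cite: BastiCenatiempoSchlein2021, Prop. 2.4] -/
theorem tsum_natCast_sq_mul_trialWeight (hσ : Function.Involutive σ) (hσz : σ z = z)
    (hP : ∀ p ∈ P, σ p ∉ P) (hN₀ : 0 ≤ N₀) (ht : ∀ p ∈ P, |t p| < 1) {ξ : MvPolynomial ι ℂ}
    (hξ : ξ ≠ 0) :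
    ∑' n : ℕ, (n : ℝ≥0∞) ^ 2 * trialWeight z σ P N₀ t ξ n =
      ENNReal.ofReal ((∑ q, ((fockInner (conjAn z σ P N₀ t q ξ) (conjAn z σ P N₀ t q ξ)).re +
          ∑ p, (fockInner (conjAn z σ P N₀ t p (conjAn z σ P N₀ t q ξ))
            (conjAn z σ P N₀ t p (conjAn z σ P N₀ t q ξ))).re)) / (fockInner ξ ξ).re) := by
  have hZ := trialNormSq_pos hσ hσz hP hN₀ ht hξ
  have hg : 0 < (gaussInner z σ P N₀ t 1 1).re :=
    lt_of_lt_of_le one_pos (one_le_gaussInner_one_one_re hσ hσz hP hN₀ ht)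
  have h := (hasSum_natCast_sq_mul_fockInner_trialSector_re hσ hσz hP hN₀ ht ξ).div_const
    ((gaussInner z σ P N₀ t 1 1).re * (fockInner ξ ξ).re)
  rw [mul_div_mul_left _ _ hg.ne'] at h
  have hpt : ∀ n : ℕ, (n : ℝ≥0∞) ^ 2 * trialWeight z σ P N₀ t ξ n =
      ENNReal.ofReal ((n : ℝ) ^ 2 * (fockInner (trialSector z σ P N₀ t ξ n)
        (trialSector z σ P N₀ t ξ n)).re / ((gaussInner z σ P N₀ t 1 1).re * (fockInner ξ ξ).re)) := by
    intro n
    rw [trialWeight, mul_div_assoc, ENNReal.ofReal_mul (sq_nonneg _), ← ENNReal.ofReal_natCast,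
      ENNReal.ofReal_pow (Nat.cast_nonneg n)]
  simp_rw [hpt]
  rw [← ENNReal.ofReal_tsum_of_nonneg (fun n => div_nonneg (mul_nonneg (sq_nonneg _)
    (fockInner_self_re_nonneg _)) hZ.le) h.summable, h.tsum_eq]

end Fock

/-! ### The energy functional -/

open Fock

section Energy

variable {ι : Type*} [Fintype ι] [DecidableEq ι] {z : ι} {σ : ι → ι} {P : Finset ι} {N₀ : ℝ}
  {t : ι → ℝ} {L : ℝ} {e : ι → Momentum}

/-- The interaction vanishes for fewer than two particles. [folklore] -/
theorem periodicInteraction_eq_zero_of_le_one {n : ℕ} (hn : n ≤ 1) (v : ℝ → ℝ≥0∞) (L : ℝ)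
    (X : Config n) : periodicInteraction v L X = 0 := by
  unfold periodicInteraction
  refine Finset.sum_eq_zero fun i _ => Finset.sum_eq_zero fun j hj => ?_
  have hij := (Finset.mem_filter.1 hj).2
  have := i.2; have := j.2
  omega

/-- **The energy of one sector, weighted**: `c_n E^per(n,L) ≤ (K_n + I_n/(2L³))/‖Ψ‖²` with
`K_n = ∑_pε(p)‖a_pΨ_n‖²`, `I_n = Re∑[…]W_L⟨a_qa_pΨ_n, a_{q'}a_{p'}Ψ_n⟩ ≥ 0` (the sectorwise
variational principle in second quantisation). [cite: LSSY2005, App. A (A.10)] -/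
theorem trialWeight_mul_periodicGroundStateEnergy_le (hσ : Function.Involutive σ) (hσz : σ z = z)
    (hP : ∀ p ∈ P, σ p ∉ P) (hN₀ : 0 ≤ N₀) (ht : ∀ p ∈ P, |t p| < 1) {ξ : MvPolynomial ι ℂ}
    (hξ : ξ ≠ 0) (hL : 0 < L) {v : ℝ → ℝ≥0∞} (hv : Measurable v)
    (hint : (∫⁻ x : Space, v ‖x‖) ≠ ⊤) (he : Function.Injective e) (n : ℕ) :
    trialWeight z σ P N₀ t ξ n * periodicGroundStateEnergy v n L ≤
      ENNReal.ofReal ((∑ p, ‖waveVector L (e p)‖ ^ 2 *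
          (fockInner (pderiv p (trialSector z σ P N₀ t ξ n)) (pderiv p (trialSector z σ P N₀ t ξ n))).re) /
        ((gaussInner z σ P N₀ t 1 1).re * (fockInner ξ ξ).re)) +
      ENNReal.ofReal ((∑ p, ∑ q, ∑ p', ∑ q', if e p + e q = e p' + e q' then
          potFT v L (e p' - e p) *
            fockInner (pderiv q (pderiv p (trialSector z σ P N₀ t ξ n)))
              (pderiv q' (pderiv p' (trialSector z σ P N₀ t ξ n))) else 0).re /
        (2 * L ^ 3 * ((gaussInner z σ P N₀ t 1 1).re * (fockInner ξ ξ).re))) := by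
  have hZ := trialNormSq_pos hσ hσz hP hN₀ ht hξ
  set S := trialSector z σ P N₀ t ξ n with hS
  by_cases hS0 : S = 0
  · have h0 : trialWeight z σ P N₀ t ξ n = 0 := by
      rw [trialWeight, ← hS, hS0, fockInner_zero_left, Complex.zero_re, zero_div, ENNReal.ofReal_zero]
    rw [h0, zero_mul]
    exact bot_le
  have hSS := fockInner_self_re_pos hS0
  have hw : trialWeight z σ P N₀ t ξ n = ENNReal.ofReal ((fockInner S S).re /
      ((gaussInner z σ P N₀ t 1 1).re * (fockInner ξ ξ).re)) := rfl
  -- the sectorwise variational bound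
  have hE : periodicGroundStateEnergy v n L ≤
      ENNReal.ofReal ((∑ p, ‖waveVector L (e p)‖ ^ 2 * (fockInner (pderiv p S) (pderiv p S)).re) /
          (fockInner S S).re) +
        ENNReal.ofReal ((∑ p, ∑ q, ∑ p', ∑ q', if e p + e q = e p' + e q' then
            potFT v L (e p' - e p) * fockInner (pderiv q (pderiv p S)) (pderiv q' (pderiv p' S)) else 0).re /
          (2 * L ^ 3 * (fockInner S S).re)) := by
    rcases Nat.lt_or_ge n 2 with hn | hn
    · -- `n ≤ 1`: no interaction
      refine (periodicGroundStateEnergy_le_sector v hL he (isHomogeneous_trialSector ξ n) hS0).trans ?_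
      have hI : ∫⁻ X in cellN n L, periodicInteraction v L X * ((‖sectorWave L e S n X‖₊ : ℝ≥0∞) ^ 2) = 0 := by
        rw [lintegral_congr (g := fun _ => 0) fun X => by
          rw [periodicInteraction_eq_zero_of_le_one (by omega) v L X, zero_mul], lintegral_zero]
      rw [← hS, hI, mul_zero, add_zero]
      exact le_self_add
    · obtain ⟨m, rfl⟩ : ∃ m, n = m + 2 := ⟨n - 2, by omega⟩
      exact periodicGroundStateEnergy_le_secondQuantised v hv hint hL he (isHomogeneous_trialSector ξ _) hS0
  refine (mul_le_mul_right hE _).trans (le_of_eq ?_)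
  rw [hw, mul_add, ← ENNReal.ofReal_mul (div_nonneg hSS.le hZ.le),
    ← ENNReal.ofReal_mul (div_nonneg hSS.le hZ.le)]
  congr 2
  · field_simp
  · field_simp

/-- **The grand-canonical energy functional of a Bogoliubov–Weyl trial state.** For admissible
Gaussian data `(z, σ, P, N₀, t)` on a finite set of modes with injective momentum labels `e`, a
finite-excitation vector `ξ ≠ 0`, `L > 0` and a measurable radial `v ≥ 0` with `∫v(|x|)dx < ∞`,
the sector weights `c_n = ‖Ψ_n‖²/‖Ψ‖²` of `Ψ = W(N₀)T_νξ` satisfy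
`∑_n c_n E^per(n, L) ≤ (∑_p |2πe(p)/L|² ‖A_pξ‖²
   + (2L³)⁻¹ Re ∑_{e p+e q = e p'+e q'} W_L(e p'-e p) ⟨A_qA_pξ, A_{q'}A_{p'}ξ⟩) / ‖ξ‖²`,
`A_p = γ_pa_p + σ_pa†_{σp} + √N₀[p=z]`, `W_L = potFT v L`: the periodic ground-state energies,
averaged over the particle-number distribution of the trial state, are bounded by
`⟨ξ, 𝒢ξ⟩/‖ξ‖²` with `𝒢 = T*W*ℋWT` the conjugated second-quantised Hamiltonian.
[cite: BastiCenatiempoSchlein2021, (2.1), (2.12), (3.1)] -/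
theorem tsum_trialWeight_mul_periodicGroundStateEnergy_le (hσ : Function.Involutive σ)
    (hσz : σ z = z) (hP : ∀ p ∈ P, σ p ∉ P) (hN₀ : 0 ≤ N₀) (ht : ∀ p ∈ P, |t p| < 1)
    {ξ : MvPolynomial ι ℂ} (hξ : ξ ≠ 0) (hL : 0 < L) {v : ℝ → ℝ≥0∞} (hv : Measurable v)
    (hint : (∫⁻ x : Space, v ‖x‖) ≠ ⊤) (he : Function.Injective e) :
    ∑' n, trialWeight z σ P N₀ t ξ n * periodicGroundStateEnergy v n L ≤
      ENNReal.ofReal ((∑ p, ‖waveVector L (e p)‖ ^ 2 *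
          (fockInner (conjAn z σ P N₀ t p ξ) (conjAn z σ P N₀ t p ξ)).re +
        (∑ p, ∑ q, ∑ p', ∑ q', if e p + e q = e p' + e q' then
          potFT v L (e p' - e p) *
            fockInner (conjAn z σ P N₀ t q (conjAn z σ P N₀ t p ξ))
              (conjAn z σ P N₀ t q' (conjAn z σ P N₀ t p' ξ)) else 0).re / (2 * L ^ 3)) /
        (fockInner ξ ξ).re) := by
  have hZ := trialNormSq_pos hσ hσz hP hN₀ ht hξ
  have hg : 0 < (gaussInner z σ P N₀ t 1 1).re :=
    lt_of_lt_of_le one_pos (one_le_gaussInner_one_one_re hσ hσz hP hN₀ ht)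
  set Z := (gaussInner z σ P N₀ t 1 1).re * (fockInner ξ ξ).re with hZdef
  -- the two sector series
  set K : ℕ → ℝ := fun n => (∑ p, ‖waveVector L (e p)‖ ^ 2 *
    (fockInner (pderiv p (trialSector z σ P N₀ t ξ n)) (pderiv p (trialSector z σ P N₀ t ξ n))).re) / Z
    with hK
  set I : ℕ → ℝ := fun n => (∑ p, ∑ q, ∑ p', ∑ q', if e p + e q = e p' + e q' then
      potFT v L (e p' - e p) * fockInner (pderiv q (pderiv p (trialSector z σ P N₀ t ξ n)))
        (pderiv q' (pderiv p' (trialSector z σ P N₀ t ξ n))) else 0).re / (2 * L ^ 3 * Z) with hI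
  have hKsum : HasSum K ((gaussInner z σ P N₀ t 1 1).re * (∑ p, ‖waveVector L (e p)‖ ^ 2 *
      (fockInner (conjAn z σ P N₀ t p ξ) (conjAn z σ P N₀ t p ξ)).re) / Z) := by
    have h := hasSum_sum (s := (Finset.univ : Finset ι)) fun p (_ : p ∈ Finset.univ) =>
      (hasSum_fockInner_pderiv_trialSector_re hσ hσz hP hN₀ ht p ξ).mul_left (‖waveVector L (e p)‖ ^ 2)
    have h' := h.div_const Z
    have hval : (∑ p, ‖waveVector L (e p)‖ ^ 2 * ((gaussInner z σ P N₀ t 1 1).re *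
        (fockInner (conjAn z σ P N₀ t p ξ) (conjAn z σ P N₀ t p ξ)).re)) / Z =
        (gaussInner z σ P N₀ t 1 1).re * (∑ p, ‖waveVector L (e p)‖ ^ 2 *
          (fockInner (conjAn z σ P N₀ t p ξ) (conjAn z σ P N₀ t p ξ)).re) / Z := by
      rw [Finset.mul_sum]
      congr 1
      refine Finset.sum_congr rfl fun p _ => ?_
      ring
    rw [← hval]
    exact h'
  have hIsum : HasSum I ((gaussInner z σ P N₀ t 1 1).re * (∑ p, ∑ q, ∑ p', ∑ q',
      if e p + e q = e p' + e q' then potFT v L (e p' - e p) *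
        fockInner (conjAn z σ P N₀ t q (conjAn z σ P N₀ t p ξ))
          (conjAn z σ P N₀ t q' (conjAn z σ P N₀ t p' ξ)) else 0).re / (2 * L ^ 3 * Z)) :=
    (hasSum_pairSum_trialSector_re hσ hσz hP hN₀ ht (potFT v L) e ξ).div_const _
  have hK0 : ∀ n, 0 ≤ K n := fun n => div_nonneg (Finset.sum_nonneg fun p _ =>
    mul_nonneg (sq_nonneg _) (fockInner_self_re_nonneg _)) hZ.le
  have hI0 : ∀ n, 0 ≤ I n := by
    intro n
    refine div_nonneg ?_ (by positivity)
    rcases Nat.lt_or_ge n 2 with hn | hn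
    · -- degree `≤ 1`: all second derivatives vanish
      have h2 : ∀ p q : ι, pderiv q (pderiv p (trialSector z σ P N₀ t ξ n)) = 0 := by
        intro p q
        interval_cases n
        · rw [pderiv_trialSector_zero, map_zero]
        · rw [pderiv_trialSector_succ hσ hP hσz ht, pderiv_trialSector_zero]
      simp [h2, fockInner_zero_left]
    · obtain ⟨m, rfl⟩ : ∃ m, n = m + 2 := ⟨n - 2, by omega⟩
      exact pairSum_re_nonneg hL hv hint he (isHomogeneous_trialSector ξ _)
  -- sum the sectorwise bounds
  calc ∑' n, trialWeight z σ P N₀ t ξ n * periodicGroundStateEnergy v n L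
      ≤ ∑' n, (ENNReal.ofReal (K n) + ENNReal.ofReal (I n)) :=
        ENNReal.tsum_le_tsum fun n =>
          trialWeight_mul_periodicGroundStateEnergy_le hσ hσz hP hN₀ ht hξ hL hv hint he n
    _ = ENNReal.ofReal (∑' n, K n) + ENNReal.ofReal (∑' n, I n) := by
        rw [ENNReal.tsum_add, ENNReal.ofReal_tsum_of_nonneg hK0 hKsum.summable,
          ENNReal.ofReal_tsum_of_nonneg hI0 hIsum.summable]
    _ = _ := by
        rw [← ENNReal.ofReal_add (tsum_nonneg hK0) (tsum_nonneg hI0), hKsum.tsum_eq, hIsum.tsum_eq]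
        congr 1
        have hξ2 : (fockInner ξ ξ).re ≠ 0 := (fockInner_self_re_pos hξ).ne'
        have hg' : (gaussInner z σ P N₀ t 1 1).re ≠ 0 := hg.ne'
        have hL3 : (2 : ℝ) * L ^ 3 ≠ 0 := by positivity
        rw [hZdef]
        field_simp

end Energy

end Literature.MathematicalPhysics.QuantumManyBody.BoseGas

end
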